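import Literature.Probability.LatticeModels.IsingFKG
import HarnessLib

/-!
# Monotonicity of finite-volume Ising expectations in the boundary condition (FKG), proved

Topic `Probability/LatticeModels`. For the finite-volume Ising model `μ^{η}_{Λ;β,h}` of
`IsingModel` on an arbitrary locally finite graph, with `β ≥ 0`, any field `h ∈ ℝ` and two fixed
boundary conditions `η₁ ≤ η₂` (coordinatewise, `-1 < 1`), every nondecreasing measurable
observable has `⟨f⟩^{η₁}_{Λ;β,h} ≤ ⟨f⟩^{η₂}_{Λ;β,h}` (Friedli–Velenik 2017, Exercise 3.13; the
`η ≡ ±1` cases are their Lemma 3.23). Proof as hinted there ("Adapt the argument in the proof of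
Lemma 3.23"): the `η₂`-weights are the `η₁`-weights tilted by the factor
`R = exp(β ∑_{i ∈ Λ, j ∉ Λ, i ∼ j} σ_i (η₂(j) - η₁(j)))`, which is nondecreasing in `σ`, so
`⟨f⟩^{η₂} ≥ ⟨f R⟩^{η₁} / ⟨R⟩^{η₁} ≥ ⟨f⟩^{η₁}` by the FKG inequality (`ising_fkg_holds`, proved
in `IsingFKG`); the first inequality also uses `f(τ·η₂) ≥ f(τ·η₁)`.

The tilt factor is written without edge-by-edge surgery as
`R(σ) = exp(-β (H^{η₂}(σ_Λ η₂) - H^{η₁}(σ_Λ η₁)))` (`bcTiltFactor`), whose monotonicity is checked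
bond by bond (`bondSpin_reglue_sub_mono`).

## References

* S. Friedli, Y. Velenik, *Statistical Mechanics of Lattice Systems* (CUP 2017), §3.6.2–3.6.3,
  Thm. 3.21 (FKG), Lemma 3.23 and Exercise 3.13.
-/

noncomputable section

open MeasureTheory Finset

namespace Literature.Probability.LatticeModels

variable {V : Type*} (G : SimpleGraph V) [DecidableEq V] [G.LocallyFinite]

/-! ### Re-gluing a configuration outside `Λ` -/

omit [DecidableEq V] [G.LocallyFinite] in
/-- `σ_Λ η`: the configuration equal to `σ` on `Λ` and to `η` off `Λ` (Friedli–Velenik's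
`ω_Λ η_{Λᶜ}`, §3.1). [cite: FriedliVelenik2017, §3.1] -/
def reglue (Λ : Finset V) (η σ : SpinConfig V) : SpinConfig V :=
  glue Λ (fun x : Λ => σ x) (.fixed η)

omit [DecidableEq V] [G.LocallyFinite] in
/-- Inside `Λ`, `σ_Λ η = σ`. [cite: FriedliVelenik2017, §3.1] -/
@[simp] theorem reglue_apply_of_mem (Λ : Finset V) (η σ : SpinConfig V) {x : V} (hx : x ∈ Λ) :
    reglue Λ η σ x = σ x := by
  simp [reglue, hx]

omit [DecidableEq V] [G.LocallyFinite] in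
/-- Outside `Λ`, `σ_Λ η = η`. [cite: FriedliVelenik2017, §3.1] -/
@[simp] theorem reglue_apply_of_notMem (Λ : Finset V) (η σ : SpinConfig V) {x : V} (hx : x ∉ Λ) :
    reglue Λ η σ x = η x := by
  simp [reglue, hx]

omit [DecidableEq V] [G.LocallyFinite] in
/-- Re-gluing a glued configuration replaces its boundary condition:
`(τ·η₁)_Λ η₂ = τ·η₂`. [cite: FriedliVelenik2017, §3.1] -/
theorem reglue_glue (Λ : Finset V) (η₁ η₂ : SpinConfig V) (τ : Λ → ℤˣ) :
    reglue Λ η₂ (glue Λ τ (.fixed η₁)) = glue Λ τ (.fixed η₂) := by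
  funext x
  by_cases hx : x ∈ Λ <;> simp [hx]

omit [DecidableEq V] [G.LocallyFinite] in
/-- `σ ↦ σ_Λ η` is measurable. [cite: FriedliVelenik2017, §6.2] -/
@[fun_prop]
theorem measurable_reglue (Λ : Finset V) (η : SpinConfig V) : Measurable (reglue Λ η) := by
  refine measurable_pi_lambda _ fun x => ?_
  by_cases hx : x ∈ Λ
  · simp only [reglue, glue_apply_of_mem Λ _ _ hx]
    exact measurable_pi_apply x
  · simp only [reglue, glue_apply_of_notMem Λ _ _ hx]
    exact measurable_const

omit [DecidableEq V] [G.LocallyFinite] in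
/-- For `η₁ ≤ η₂`, the glued configurations compare: `τ·η₁ ≤ τ·η₂`.
[cite: FriedliVelenik2017, Exercise 3.13] -/
theorem glue_fixed_mono_bc (Λ : Finset V) {η₁ η₂ : SpinConfig V} (hη : η₁ ≤ η₂) (τ : Λ → ℤˣ) :
    glue Λ τ (.fixed η₁) ≤ glue Λ τ (.fixed η₂) := by
  intro x
  by_cases hx : x ∈ Λ
  · simp [hx]
  · simpa [hx] using hη x

/-! ### The tilt between two boundary conditions -/

omit [DecidableEq V] [G.LocallyFinite] in
/-- Bond by bond, `σ ↦ σ_e(σ_Λ η₂) - σ_e(σ_Λ η₁)` is nondecreasing when `η₁ ≤ η₂`: it is `0` for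
an edge inside `Λ`, `σ_i (η₂(j) - η₁(j))` with `η₂(j) - η₁(j) ≥ 0` for a boundary edge, and a
constant for an edge off `Λ`. [cite: FriedliVelenik2017, Exercise 3.13 and proof of Lemma 3.23] -/
theorem bondSpin_reglue_sub_mono (Λ : Finset V) {η₁ η₂ : SpinConfig V} (hη : η₁ ≤ η₂)
    (e : Sym2 V) :
    Monotone fun σ : SpinConfig V => bondSpin (reglue Λ η₂ σ) e - bondSpin (reglue Λ η₁ σ) e := by
  induction e using Sym2.ind with
  | _ a b =>
    intro σ σ' hle
    have hηa : spinAt a η₁ ≤ spinAt a η₂ := spinAt_mono a hη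
    have hηb : spinAt b η₁ ≤ spinAt b η₂ := spinAt_mono b hη
    have hσa : spinAt a σ ≤ spinAt a σ' := spinAt_mono a hle
    have hσb : spinAt b σ ≤ spinAt b σ' := spinAt_mono b hle
    simp only [spinAt] at hηa hηb hσa hσb
    simp only [bondSpin_mk, spinAt]
    by_cases ha : a ∈ Λ
    · by_cases hb : b ∈ Λ
      · -- both inside: the difference is `0`
        simp [reglue_apply_of_mem Λ _ _ ha, reglue_apply_of_mem Λ _ _ hb]
      · -- `a ∈ Λ`, `b ∉ Λ`: `σ_a (η₂ b - η₁ b)`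
        simp only [reglue_apply_of_mem Λ _ _ ha, reglue_apply_of_notMem Λ _ _ hb]
        nlinarith [mul_nonneg (sub_nonneg.2 hσa) (sub_nonneg.2 hηb)]
    · by_cases hb : b ∈ Λ
      · -- `a ∉ Λ`, `b ∈ Λ`: `(η₂ a - η₁ a) σ_b`
        simp only [reglue_apply_of_notMem Λ _ _ ha, reglue_apply_of_mem Λ _ _ hb]
        nlinarith [mul_nonneg (sub_nonneg.2 hηa) (sub_nonneg.2 hσb)]
      · -- both outside: constant
        simp [reglue_apply_of_notMem Λ _ _ ha, reglue_apply_of_notMem Λ _ _ hb]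

/-- The tilt factor between the boundary conditions `η₁` and `η₂`:
`R(σ) = exp(-β (H^{η₂}_{Λ;h}(σ_Λ η₂) - H^{η₁}_{Λ;h}(σ_Λ η₁)))`, i.e.
`exp(β ∑_{i∈Λ, j∉Λ, i∼j} σ_i (η₂(j) - η₁(j)))` (the analogue of Friedli–Velenik's
`I(ω) = exp{β ∑_{i∈Λ,j∉Λ,i∼j} ω_i}` in the proof of Lemma 3.23).
[cite: FriedliVelenik2017, proof of Lemma 3.23 and Exercise 3.13] -/
def bcTiltFactor (Λ : Finset V) (β h : ℝ) (η₁ η₂ : SpinConfig V) (σ : SpinConfig V) : ℝ :=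
  Real.exp (-β * (isingHamiltonian G Λ h (.fixed η₂) (reglue Λ η₂ σ) -
    isingHamiltonian G Λ h (.fixed η₁) (reglue Λ η₁ σ)))

/-- `R > 0`. [cite: FriedliVelenik2017, proof of Lemma 3.23] -/
theorem bcTiltFactor_pos (Λ : Finset V) (β h : ℝ) (η₁ η₂ σ : SpinConfig V) :
    0 < bcTiltFactor G Λ β h η₁ η₂ σ :=
  Real.exp_pos _

/-- `R` is measurable. [cite: FriedliVelenik2017, §6.2] -/
@[fun_prop]
theorem measurable_bcTiltFactor (Λ : Finset V) (β h : ℝ) (η₁ η₂ : SpinConfig V) :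
    Measurable (bcTiltFactor G Λ β h η₁ η₂) := by
  unfold bcTiltFactor
  refine Real.measurable_exp.comp (Measurable.const_mul (Measurable.sub ?_ ?_) _)
  · exact (measurable_isingHamiltonian G Λ h _).comp (measurable_reglue Λ η₂)
  · exact (measurable_isingHamiltonian G Λ h _).comp (measurable_reglue Λ η₁)

/-- The exponent of `R`: `-(H^{η₂}(σ_Λ η₂) - H^{η₁}(σ_Λ η₁)) = ∑_{e ∈ ℰ^b_Λ} (σ_e(σ_Λ η₂) - σ_e(σ_Λ η₁))`
(the field terms cancel since `σ_Λ η₂ = σ_Λ η₁ = σ` on `Λ`).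
[cite: FriedliVelenik2017, §3.1 eq. (3.6) and proof of Lemma 3.23] -/
theorem neg_isingHamiltonian_reglue_sub (Λ : Finset V) (h : ℝ) (η₁ η₂ σ : SpinConfig V) :
    -(isingHamiltonian G Λ h (.fixed η₂) (reglue Λ η₂ σ) -
        isingHamiltonian G Λ h (.fixed η₁) (reglue Λ η₁ σ)) =
      ∑ e ∈ edgesTouching G Λ, (bondSpin (reglue Λ η₂ σ) e - bondSpin (reglue Λ η₁ σ) e) := by
  have hfield : ∑ x ∈ Λ, spinAt x (reglue Λ η₂ σ) = ∑ x ∈ Λ, spinAt x (reglue Λ η₁ σ) :=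
    Finset.sum_congr rfl fun x hx => by simp [spinAt, reglue_apply_of_mem Λ _ _ hx]
  simp only [isingHamiltonian, interactionEdges_fixed, hfield, Finset.sum_sub_distrib]
  ring

/-- `R` is nondecreasing for `β ≥ 0` and `η₁ ≤ η₂`. [cite: FriedliVelenik2017, Exercise 3.13] -/
theorem bcTiltFactor_mono (Λ : Finset V) {β : ℝ} (hβ : 0 ≤ β) (h : ℝ) {η₁ η₂ : SpinConfig V}
    (hη : η₁ ≤ η₂) : Monotone (bcTiltFactor G Λ β h η₁ η₂) := by
  intro σ σ' hle
  unfold bcTiltFactor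
  refine Real.exp_le_exp.2 ?_
  rw [neg_mul, neg_mul, ← mul_neg, ← mul_neg, neg_isingHamiltonian_reglue_sub,
    neg_isingHamiltonian_reglue_sub]
  refine mul_le_mul_of_nonneg_left (Finset.sum_le_sum fun e _ => ?_) hβ
  exact bondSpin_reglue_sub_mono Λ hη e hle

/-- **The `η₂`-weights are the tilted `η₁`-weights**: `w^{η₂}(τ) = w^{η₁}(τ) · R(τ·η₁)`.
[cite: FriedliVelenik2017, proof of Lemma 3.23 and Exercise 3.13] -/
theorem isingWeight_fixed_eq_mul_bcTiltFactor (Λ : Finset V) (β h : ℝ) (η₁ η₂ : SpinConfig V)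
    (τ : Λ → ℤˣ) :
    isingWeight G Λ β h (.fixed η₂) τ =
      isingWeight G Λ β h (.fixed η₁) τ * bcTiltFactor G Λ β h η₁ η₂ (glue Λ τ (.fixed η₁)) := by
  rw [isingWeight, isingWeight, bcTiltFactor, ← Real.exp_add, reglue_glue, reglue_glue]
  congr 1
  ring

/-! ### Monotonicity in the boundary condition -/

/-- **Friedli–Velenik 2017, Exercise 3.13 (monotonicity in the boundary condition), proved.**
For `β ≥ 0`, any `h ∈ ℝ`, any finite `Λ`, boundary conditions `η₁ ≤ η₂` and every nondecreasing
measurable `f`: `⟨f⟩^{η₁}_{Λ;β,h} ≤ ⟨f⟩^{η₂}_{Λ;β,h}`. Proof ("Adapt the argument in the proof of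
Lemma 3.23"): `⟨f⟩^{η₂} = ∑_τ w^{η₂}(τ) f(τ·η₂)/Z^{η₂} ≥ ∑_τ w^{η₂}(τ) f(τ·η₁)/Z^{η₂}
= ⟨f R⟩^{η₁}/⟨R⟩^{η₁} ≥ ⟨f⟩^{η₁}`, by `f(τ·η₂) ≥ f(τ·η₁)`, the tilt identity
`w^{η₂} = w^{η₁} R` and the FKG inequality for the nondecreasing `R` (`ising_fkg_holds`).
[cite: FriedliVelenik2017, Exercise 3.13] -/
theorem isingExpect_fixed_mono {β : ℝ} (hβ : 0 ≤ β) (Λ : Finset V) (h : ℝ)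
    {η₁ η₂ : SpinConfig V} (hη : η₁ ≤ η₂) {f : SpinConfig V → ℝ} (hf : Monotone f)
    (hfm : Measurable f) :
    isingExpect G Λ β h (.fixed η₁) f ≤ isingExpect G Λ β h (.fixed η₂) f := by
  set R : SpinConfig V → ℝ := bcTiltFactor G Λ β h η₁ η₂ with hRdef
  have hR : Measurable R := measurable_bcTiltFactor G Λ β h η₁ η₂
  have hRmono : Monotone R := bcTiltFactor_mono G Λ hβ h hη
  have hRpos : ∀ σ, 0 < R σ := bcTiltFactor_pos G Λ β h η₁ η₂
  have hZ₂ := isingPartitionFunction_pos G Λ β h (.fixed η₂)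
  -- Step 1: replace `f(τ·η₂)` by the smaller `f(τ·η₁)` in the `η₂`-average
  have step1 : (∑ τ : Λ → ℤˣ, isingWeight G Λ β h (.fixed η₂) τ * f (glue Λ τ (.fixed η₁))) /
      isingPartitionFunction G Λ β h (.fixed η₂) ≤ isingExpect G Λ β h (.fixed η₂) f := by
    rw [isingExpect_eq_sum_div G Λ h (.fixed η₂) β hfm]
    refine div_le_div_of_nonneg_right (Finset.sum_le_sum fun τ _ => ?_) hZ₂.le
    exact mul_le_mul_of_nonneg_left (hf (glue_fixed_mono_bc Λ hη τ))
      (isingWeight_pos G Λ β h _ τ).le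
  -- Step 2: the left-hand side is `⟨f R⟩^{η₁} / ⟨R⟩^{η₁}`
  have hfR : isingExpect G Λ β h (.fixed η₁) (fun σ => f σ * R σ) =
      (∑ τ : Λ → ℤˣ, isingWeight G Λ β h (.fixed η₂) τ * f (glue Λ τ (.fixed η₁))) /
        isingPartitionFunction G Λ β h (.fixed η₁) := by
    rw [isingExpect_eq_sum_div G Λ h (.fixed η₁) β (f := fun σ => f σ * R σ) (hfm.mul hR)]
    congr 1
    refine Finset.sum_congr rfl fun τ _ => ?_
    rw [isingWeight_fixed_eq_mul_bcTiltFactor G Λ β h η₁ η₂ τ]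
    ring
  have hRexp : isingExpect G Λ β h (.fixed η₁) R =
      isingPartitionFunction G Λ β h (.fixed η₂) / isingPartitionFunction G Λ β h (.fixed η₁) := by
    rw [isingExpect_eq_sum_div G Λ h (.fixed η₁) β hR]
    congr 1
    simp only [isingPartitionFunction]
    refine Finset.sum_congr rfl fun τ _ => ?_
    rw [isingWeight_fixed_eq_mul_bcTiltFactor G Λ β h η₁ η₂ τ]
  have hZ₁ := isingPartitionFunction_pos G Λ β h (.fixed η₁)
  have hRexp_pos : 0 < isingExpect G Λ β h (.fixed η₁) R := by
    rw [hRexp]; exact div_pos hZ₂ hZ₁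
  have step2 : (∑ τ : Λ → ℤˣ, isingWeight G Λ β h (.fixed η₂) τ * f (glue Λ τ (.fixed η₁))) /
      isingPartitionFunction G Λ β h (.fixed η₂) =
        isingExpect G Λ β h (.fixed η₁) (fun σ => f σ * R σ) /
          isingExpect G Λ β h (.fixed η₁) R := by
    rw [hfR, hRexp, div_div_div_cancel_right₀ hZ₁.ne']
  -- Step 3: FKG
  have step3 : isingExpect G Λ β h (.fixed η₁) f ≤
      isingExpect G Λ β h (.fixed η₁) (fun σ => f σ * R σ) / isingExpect G Λ β h (.fixed η₁) R := by
    rw [le_div_iff₀ hRexp_pos]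
    exact ising_fkg_holds G hβ Λ h (.fixed η₁) f R hf hRmono hfm hR
  calc isingExpect G Λ β h (.fixed η₁) f
      ≤ isingExpect G Λ β h (.fixed η₁) (fun σ => f σ * R σ) /
          isingExpect G Λ β h (.fixed η₁) R := step3
    _ = (∑ τ : Λ → ℤˣ, isingWeight G Λ β h (.fixed η₂) τ * f (glue Λ τ (.fixed η₁))) /
          isingPartitionFunction G Λ β h (.fixed η₂) := step2.symm
    _ ≤ isingExpect G Λ β h (.fixed η₂) f := step1

/-- The same in integral notation: `∫ f dμ^{η₁}_{Λ;β,h} ≤ ∫ f dμ^{η₂}_{Λ;β,h}` for `η₁ ≤ η₂`,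
`β ≥ 0`, `f` nondecreasing and measurable. [cite: FriedliVelenik2017, Exercise 3.13] -/
theorem integral_isingMeasure_fixed_mono {β : ℝ} (hβ : 0 ≤ β) (Λ : Finset V) (h : ℝ)
    {η₁ η₂ : SpinConfig V} (hη : η₁ ≤ η₂) {f : SpinConfig V → ℝ} (hf : Monotone f)
    (hfm : Measurable f) :
    ∫ σ, f σ ∂(isingMeasure G Λ β h (.fixed η₁)) ≤ ∫ σ, f σ ∂(isingMeasure G Λ β h (.fixed η₂)) :=
  isingExpect_fixed_mono G hβ Λ h hη hf hfm

omit [DecidableEq V] [G.LocallyFinite] in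
/-- Every spin is `≤ +1` (the order `-1 < 1` on `ℤˣ`). [cite: FriedliVelenik2017, §3.6.2] -/
theorem intUnits_le_one (u : ℤˣ) : u ≤ 1 := by
  rcases Int.units_eq_one_or u with rfl | rfl <;> decide

omit [DecidableEq V] [G.LocallyFinite] in
/-- Every spin is `≥ -1`. [cite: FriedliVelenik2017, §3.6.2] -/
theorem neg_one_le_intUnits (u : ℤˣ) : -1 ≤ u := by
  rcases Int.units_eq_one_or u with rfl | rfl <;> decide

/-- **Friedli–Velenik 2017, Lemma 3.23 (the `+` boundary condition is extremal), fixed-boundary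
form**: `⟨f⟩^{η}_{Λ;β,h} ≤ ⟨f⟩^{+}_{Λ;β,h}` for every boundary condition `η`, `β ≥ 0` and
nondecreasing measurable `f`. [cite: FriedliVelenik2017, Lemma 3.23] -/
theorem isingExpect_fixed_le_plus {β : ℝ} (hβ : 0 ≤ β) (Λ : Finset V) (h : ℝ) (η : SpinConfig V)
    {f : SpinConfig V → ℝ} (hf : Monotone f) (hfm : Measurable f) :
    isingExpect G Λ β h (.fixed η) f ≤ isingExpect G Λ β h .plus f :=
  isingExpect_fixed_mono G hβ Λ h (fun x => intUnits_le_one (η x)) hf hfm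

/-- **Friedli–Velenik 2017, Lemma 3.23, `-` form**: `⟨f⟩^{-}_{Λ;β,h} ≤ ⟨f⟩^{η}_{Λ;β,h}`.
[cite: FriedliVelenik2017, Lemma 3.23] -/
theorem isingExpect_minus_le_fixed {β : ℝ} (hβ : 0 ≤ β) (Λ : Finset V) (h : ℝ) (η : SpinConfig V)
    {f : SpinConfig V → ℝ} (hf : Monotone f) (hfm : Measurable f) :
    isingExpect G Λ β h .minus f ≤ isingExpect G Λ β h (.fixed η) f :=
  isingExpect_fixed_mono G hβ Λ h (fun x => neg_one_le_intUnits (η x)) hf hfm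

end Literature.Probability.LatticeModels

end
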